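import Summits.BirchSwinnertonDyer.BirchSwinnertonDyer.Theorems.OneSidedTwistSqueezeX9KatoDivisibilityX9GradedCoreAlgebra
import Literature.NumberTheory.EllipticCurves.IwasawaTwistModPkDual
import HarnessLib

set_option autoImplicit false

-- the summit and its single problem are both named `BirchSwinnertonDyer` (registry layout D-0017)
set_option linter.dupNamespace false

/-!
# Stub `stub_reciprocityPkX9` (hG34ᵍ) of line `graded_euler_loss`, crux `KatoDivisibilityX9`
# (stmt-BirchSwinnertonDyer-20547): the TRANSFER algebra — polynomials in the shift modulo `p^k`,
# `ω`-annihilation of `(γ^t − 1)`-coboundaries, transfer of `p^d` across the convolution coefficients with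
# change of pairing `E[p^k] → E[p]`, and the level change `2e(d+1) → 2e`

Seat `bsd-line-k6-p4` (prover-bsd-line-k6-p4-g5-0, stub worker for `stub_reciprocityPkX9`).  THEOREMS ONLY, sorry-free,
pure algebra on the coordinate modules `Fin J → M` of the tree's Iwasawa twists (`shiftEnd`, `unipotentPow`,
`convCoeff` of `IwasawaTwistModP(Dual)` / `IwasawaTwistModPk(Dual)`); no definition, no named fact, nothing asserted
about any curve.  `--supports stmt-BirchSwinnertonDyer-20547 --as helper`.

WHERE IT SITS (MEMO-es §15 STEP 4, «(transfer)» of the stub brief).  The level-`p^{d+1}` Kolyvagin class of the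
genuine Euler system `s = p^d s'` has, at an `E[p^{d+1}]`-split Kolyvagin prime, the value `V(S)·φ(r)` with `φ` a
cocycle of the level-`p^{d+1}` reduction of `s` and `V ∈ ℤ[X]` an `ω`-ANNIHILATING polynomial
(`p^{d+1} ∣ (V·ω_N)_i` for `i < L`, `ω_N = (X+1)^{p^N} − 1`) which is a UNIT MULTIPLE OF `X^{L−e}` MODULO `p`.  The four
moves that turn the level-`p^{d+1}` reciprocity `C_i(V(S)φ(r), Ψ̃(r)) = 0` (`i + ε < L`) into the mod-`p` conclusion of
the stub are proved here in full generality: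

* §1 `aeval_shiftEnd_eq_zero_of_forall_dvd_coeff` — on `Fin J → M` with `n • M = 0`, a polynomial whose coefficients
  of index `< J` are divisible by `n` acts by `0`; `aeval_shiftEnd_apply_eq_of_forall_dvd_coeff_sub` (two polynomials
  congruent mod `(n, X^J)` act alike); `unipotentPow_eq_aeval` (`(1+S)^a = ((X+1)^a)(S)`);
  **`aeval_shiftEnd_unipotentPow_sub_eq_zero`** — if `n ∣ (V·((X+1)^e − 1))_i` for `i < J` and `e ∣ t`, then
  `V(S)·((1+S)^t x − x) = 0`: the `ω`-annihilating `V` kills every `(γ^t − 1)`-coboundary of depth `≥ N` (`e = p^N`).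
* §2 `convCoeff_aeval_comm` — `C_k(F(S)x, y) = C_k(x, F(S)y)` (`k < J`; `S` is self-adjoint);
  **`convCoeff_nsmul_left_eq_map_of_forall_nsmul_eq`** — for pairings `e_k : M_k × M_k' → P_k`, `e₁ : M₁ × M₁' → P₁`
  compatible along `(red : M_k → M₁, ι' : M₁' → M_k', j : P₁ → P_k)` (`e_k(m, ι' m') = j(e₁(red m, m'))`, e.g. the
  Weil pairings `e_{p^k}(P, Q) = e_p(p^{k−1}P, Q)` for `Q ∈ E[p]`): if `c • y = ι' ∘ z` then
  `C^{e_k}_i(c • x, y) = j(C^{e₁}_i(red ∘ x, z))` — the transfer `⟨p^d t', Y⟩ = ⟨t', p^d Y⟩ = ι⟨t̄', ȳ⟩`.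
* §3 `aeval_shiftEnd_comp_castLE` (truncation commutes with polynomials in the shift) and
  **`convCoeff_castLE_aeval_shiftEnd_pow_eq`** — `C^{(J')}_i(U(S)S^b x̄, ȳ) = C^{(L)}_{(L−J')+i}(U(S)S^{(L−J')+b} x, y)`
  for the truncations `x̄, ȳ` to level `J' ≤ L` and `i < J'`: the level change `L = 2e(d+1) → 2e` of the conclusion.

HONEST LABEL: bookkeeping only; the stub `stub_reciprocityPkX9` stays OPEN (its level-`p^{d+1}` Kolyvagin package and
local reciprocity are not in the tree, see the companion assembly file); crux 20547 / B2 untouched; BSD is not advanced.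

References: B. Mazur, K. Rubin, Mem. AMS 799 (2004) §1.3, §5.3 [MazurRubin2004]; B. Howard, Compositio 140 (2004)
Prop. 3.2.4 [Howard2004HeegnerKolyvagin]; L. Washington, GTM 83, §13.1–13.2 [Washington1997]; J. H. Silverman, AEC III.8.1
[SilvermanAEC2009]; HOME/MEMO-es.md §15 STEP 4.
-/

noncomputable section

open Polynomial
open Literature.NumberTheory.GaloisRepresentations
open Literature.NumberTheory.EllipticCurves

namespace Summit.BirchSwinnertonDyer.BirchSwinnertonDyer.Theorems.OneSidedTwistSqueezeX9KatoDivisibilityX9StubReciprocityPkX9Transfer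

open Summit.BirchSwinnertonDyer.BirchSwinnertonDyer.Rank1Residual.CoreAssembly
open Summit.BirchSwinnertonDyer.BirchSwinnertonDyer.Theorems.OneSidedTwistSqueezeX9KatoDivisibilityX9GradedCoreAlgebra

/-! ## §1 Polynomials in the shift modulo `n` -/

section ShiftPoly

variable {M : Type*} [AddCommGroup M] {J : ℕ} {n : ℕ}

/-- **A polynomial whose coefficients of index `< J` are divisible by `n` acts by `0` on `Fin J → M` when
`n • M = 0`** (`F(S) = Σ_i F_i S^i`, `S^i = 0` for `i ≥ J`). [cite: Washington1997, §13.1–§13.2] -/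
theorem aeval_shiftEnd_eq_zero_of_forall_dvd_coeff (hM : ∀ x : M, n • x = 0) (F : ℤ[X])
    (hF : ∀ i, i < J → (n : ℤ) ∣ F.coeff i) : aeval (shiftEnd M J) F = 0 := by
  rw [aeval_eq_sum_range]
  refine Finset.sum_eq_zero fun i _ => ?_
  by_cases hi : i < J
  · obtain ⟨c, hc⟩ := hF i hi
    rw [hc]
    refine LinearMap.ext fun x => ?_
    rw [LinearMap.smul_apply, LinearMap.zero_apply, mul_comm, mul_smul, natCast_zsmul]
    refine funext fun j => ?_
    rw [Pi.smul_apply, Pi.zero_apply, Pi.smul_apply]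
    rw [hM, smul_zero]
  · rw [shiftEnd_pow_eq_zero (not_lt.mp hi), smul_zero]

/-- Two integer polynomials congruent modulo `(n, X^J)` act alike on `Fin J → M` when `n • M = 0`.
[cite: Washington1997, §13.1–§13.2] -/
theorem aeval_shiftEnd_apply_eq_of_forall_dvd_coeff_sub (hM : ∀ x : M, n • x = 0) (F G : ℤ[X])
    (h : ∀ i, i < J → (n : ℤ) ∣ (F - G).coeff i) (x : Fin J → M) :
    aeval (shiftEnd M J) F x = aeval (shiftEnd M J) G x := by
  have h0 := aeval_shiftEnd_eq_zero_of_forall_dvd_coeff hM (F - G) h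
  rw [map_sub, sub_eq_zero] at h0
  rw [h0]

/-- `(1+S)^a = ((X+1)^a)(S)`. [cite: Washington1997, §13.1–§13.2] -/
theorem unipotentPow_eq_aeval (a : ℕ) :
    unipotentPow M J a = aeval (shiftEnd M J) ((X + 1 : ℤ[X]) ^ a) := by
  rw [map_pow, map_add, aeval_X, map_one, add_comm]
  rfl

/-- **`ω`-annihilation of `(γ^t − 1)`-coboundaries.**  If `n ∣ (V·((X+1)^e − 1))_i` for all `i < J` (i.e.
`V·ω ≡ 0 (mod n, X^J)` with `ω = (X+1)^e − 1`) and `e ∣ t`, then `V(S)·((1+S)^t x − x) = 0` on `Fin J → M`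
(`n • M = 0`): indeed `(X+1)^t − 1 = ω·Q`.  With `e = p^N` and `t` the twist exponent of an element of
`Gal(K̄/K_N)` this says that the `ω_N`-annihilating polynomial `V` kills the coboundary `(g − 1)b` of every `b`.
[cite: Washington1997, §13.1–§13.2] [cite: MazurRubin2004, §5.3] -/
theorem aeval_shiftEnd_unipotentPow_sub_eq_zero (hM : ∀ x : M, n • x = 0) {e : ℕ} (V : ℤ[X])
    (hV : ∀ i, i < J → (n : ℤ) ∣ (V * ((X + 1) ^ e - 1)).coeff i) {t : ℕ} (ht : e ∣ t) (x : Fin J → M) :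
    aeval (shiftEnd M J) V (unipotentPow M J t x - x) = 0 := by
  obtain ⟨u, rfl⟩ := ht
  obtain ⟨Q, hQ⟩ : ((X + 1 : ℤ[X]) ^ e - 1) ∣ ((X + 1 : ℤ[X]) ^ (e * u) - 1) := by
    simpa only [pow_mul, one_pow] using sub_dvd_pow_sub_pow ((X + 1 : ℤ[X]) ^ e) 1 u
  have h1 : unipotentPow M J (e * u) x - x = aeval (shiftEnd M J) ((X + 1 : ℤ[X]) ^ (e * u) - 1) x := by
    rw [map_sub, map_one, LinearMap.sub_apply, Module.End.one_apply, unipotentPow_eq_aeval]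
  rw [h1, ← Module.End.mul_apply, ← map_mul, hQ, ← mul_assoc, map_mul, Module.End.mul_apply,
    aeval_shiftEnd_eq_zero_of_forall_dvd_coeff hM _ hV, LinearMap.zero_apply]

/-- Variant: `V(S)((1+S)^t x) = V(S) x`. [cite: Washington1997, §13.1–§13.2] -/
theorem aeval_shiftEnd_unipotentPow_eq (hM : ∀ x : M, n • x = 0) {e : ℕ} (V : ℤ[X])
    (hV : ∀ i, i < J → (n : ℤ) ∣ (V * ((X + 1) ^ e - 1)).coeff i) {t : ℕ} (ht : e ∣ t) (x : Fin J → M) :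
    aeval (shiftEnd M J) V (unipotentPow M J t x) = aeval (shiftEnd M J) V x := by
  rw [← sub_eq_zero, ← map_sub]
  exact aeval_shiftEnd_unipotentPow_sub_eq_zero hM V hV ht x

/-- On an `n`-torsion-valued vector a polynomial `V ≡ U·X^m (mod n, X^J)` acts as `U(S)·S^m`.
[cite: Washington1997, §13.1–§13.2] -/
theorem aeval_shiftEnd_apply_eq_aeval_shiftEnd_pow (hM : ∀ x : M, n • x = 0) (V U : ℤ[X]) (m : ℕ)
    (h : ∀ i, i < J → (n : ℤ) ∣ (V - U * X ^ m).coeff i) (x : Fin J → M) :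
    aeval (shiftEnd M J) V x = aeval (shiftEnd M J) U ((shiftEnd M J ^ m) x) := by
  rw [aeval_shiftEnd_apply_eq_of_forall_dvd_coeff_sub hM V (U * X ^ m) h x, map_mul, map_pow, aeval_X,
    Module.End.mul_apply]

variable {M' : Type*} [AddCommGroup M'] {Φ : Type*} [FunLike Φ M M'] [AddMonoidHomClass Φ M M']

/-- An additive map applied coordinatewise commutes with every polynomial in the shift:
`f ∘ (F(S) x) = F(S) (f ∘ x)` (e.g. the reduction `E[p^k] → E[p]` or `E[p] ⊂ E[p^k]` coordinatewise).
[cite: Washington1997, §13.1–§13.2] -/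
theorem map_aeval_shiftEnd_apply (f : Φ) (F : ℤ[X]) (x : Fin J → M) :
    (fun l => f (aeval (shiftEnd M J) F x l)) = aeval (shiftEnd M' J) F (fun l => f (x l)) := by
  induction F using Polynomial.induction_on' with
  | add F G hF hG =>
    rw [map_add, map_add, LinearMap.add_apply, LinearMap.add_apply, ← hF, ← hG]
    funext l
    exact map_add f _ _
  | monomial i c =>
    rw [aeval_monomial, aeval_monomial, Module.End.mul_apply, Module.End.mul_apply,
      Module.algebraMap_end_apply, Module.algebraMap_end_apply]
    have hpow : ∀ (a : ℕ) (v : Fin J → M), (fun l => f ((shiftEnd M J ^ a) v l)) =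
        (shiftEnd M' J ^ a) (fun l => f (v l)) := by
      intro a v
      induction a generalizing v with
      | zero => rfl
      | succ a ih => rw [pow_succ, pow_succ, Module.End.mul_apply, Module.End.mul_apply, ih, map_shiftEnd_apply]
    rw [← hpow]
    funext l
    exact map_zsmul f c _

end ShiftPoly

/-! ## §2 Convolution coefficients: `S`-adjointness of polynomials and the transfer of `p^d` with change of pairing -/

section Conv

variable {M M' P : Type*} [AddCommGroup M] [AddCommGroup M'] [AddCommGroup P] (e : M →+ M' →+ P) {J : ℕ}

/-- **Every polynomial in the shift is self-adjoint for the convolution coefficients of index `< J`**: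
`C_k(F(S) x, y) = C_k(x, F(S) y)`. [cite: Howard2004HeegnerKolyvagin, Prop. 3.2.4] -/
theorem convCoeff_aeval_comm (F : ℤ[X]) {k : ℕ} (hk : k < J) (x : Fin J → M) (y : Fin J → M') :
    convCoeff e J k (aeval (shiftEnd M J) F x) y = convCoeff e J k x (aeval (shiftEnd M' J) F y) := by
  induction F using Polynomial.induction_on' with
  | add F G hF hG =>
    rw [map_add, map_add, LinearMap.add_apply, LinearMap.add_apply, convCoeff_add_left, convCoeff_add_right,
      hF, hG]
  | monomial i c =>
    rw [aeval_monomial, aeval_monomial, Module.End.mul_apply, Module.End.mul_apply,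
      Module.algebraMap_end_apply, Module.algebraMap_end_apply]
    have h1 : convCoeff e J k (c • (shiftEnd M J ^ i) x) y = c • convCoeff e J k ((shiftEnd M J ^ i) x) y :=
      map_zsmul ((convCoeffHom e J k).flip y) c _
    have h2 : convCoeff e J k x (c • (shiftEnd M' J ^ i) y) = c • convCoeff e J k x ((shiftEnd M' J ^ i) y) :=
      map_zsmul (convCoeffHom e J k x) c _
    rw [h1, h2, convCoeff_shiftEnd_pow_comm e hk]

variable {Mk Mk' Pk M₁ M₁' P₁ : Type*} [AddCommGroup Mk] [AddCommGroup Mk'] [AddCommGroup Pk]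
  [AddCommGroup M₁] [AddCommGroup M₁'] [AddCommGroup P₁]

/-- **Change of pairing along a compatible triple.**  Let `e_k : M_k × M_k' → P_k` and `e₁ : M₁ × M₁' → P₁` be
biadditive and compatible along additive maps `red : M_k → M₁`, `ι' : M₁' → M_k'`, `j : P₁ → P_k`:
`e_k(m, ι' m') = j(e₁(red m, m'))` (for the Weil pairings: `e_{p^k}(P, Q) = e_p(p^{k−1}P, Q)` for
`Q ∈ E[p] ⊂ E[p^k]`, `μ_p ⊂ μ_{p^k}`).  Then `C^{e_k}_i(x, ι' ∘ z) = j(C^{e₁}_i(red ∘ x, z))`.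
[cite: Howard2004HeegnerKolyvagin, Prop. 3.2.4] [cite: SilvermanAEC2009, III.§8 (Prop. 8.1 (e))] -/
theorem convCoeff_comp_right_eq_map (ek : Mk →+ Mk' →+ Pk) (e₁ : M₁ →+ M₁' →+ P₁)
    (red : Mk →+ M₁) (ι' : M₁' →+ Mk') (j : P₁ →+ Pk) (hcomp : ∀ m m', ek m (ι' m') = j (e₁ (red m) m'))
    (J : ℕ) (i : ℕ) (x : Fin J → Mk) (z : Fin J → M₁') :
    convCoeff ek J i x (fun l => ι' (z l)) = j (convCoeff e₁ J i (fun l => red (x l)) z) := by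
  have h1 := convCoeff_map₂ (e := (e₁ : M₁ →+ M₁' →+ P₁).comp red) J (e₂ := ek) (AddMonoidHom.id Mk) ι' j
    (fun m m' => by rw [AddMonoidHom.id_apply, hcomp]; rfl) i x z
  have h2 := convCoeff_map₂ (e := (e₁ : M₁ →+ M₁' →+ P₁).comp red) J (e₂ := e₁) red (AddMonoidHom.id M₁')
    (AddMonoidHom.id P₁) (fun m m' => rfl) i x z
  simp only [AddMonoidHom.id_apply] at h1 h2
  rw [h1, ← h2]

/-- **Transfer of a scalar across the convolution coefficients with change of pairing**: in the situation of
`convCoeff_comp_right_eq_map`, if `c • y = ι' ∘ z` coordinatewise then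
`C^{e_k}_i(c • x, y) = C^{e_k}_i(x, c • y) = j(C^{e₁}_i(red ∘ x, z))` — the step
`⟨p^d t', Y⟩ = ⟨t', p^d Y⟩ = ι⟨t̄', ȳ⟩` of MEMO-es §15 STEP 4. [cite: Howard2004HeegnerKolyvagin, Prop. 3.2.4]
[cite: SilvermanAEC2009, III.§8 (Prop. 8.1 (e))] -/
theorem convCoeff_nsmul_left_eq_map_of_forall_nsmul_eq (ek : Mk →+ Mk' →+ Pk) (e₁ : M₁ →+ M₁' →+ P₁)
    (red : Mk →+ M₁) (ι' : M₁' →+ Mk') (j : P₁ →+ Pk) (hcomp : ∀ m m', ek m (ι' m') = j (e₁ (red m) m'))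
    (J : ℕ) (c i : ℕ) (x : Fin J → Mk) (y : Fin J → Mk') (z : Fin J → M₁')
    (hyz : ∀ l, c • y l = ι' (z l)) :
    convCoeff ek J i (c • x) y = j (convCoeff e₁ J i (fun l => red (x l)) z) := by
  have hy : c • y = fun l => ι' (z l) := funext fun l => by rw [Pi.smul_apply, hyz]
  rw [convCoeff_nsmul_left_eq_right, hy]
  exact convCoeff_comp_right_eq_map ek e₁ red ι' j hcomp J i x z

/-- Scaling the pairing scales every convolution coefficient: `C^{c • e}_i = c • C^{e}_i`.
[cite: MazurRubin2004, §1.3 and §5.3] -/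
theorem convCoeff_zsmul_pairing (c : ℤ) (J i : ℕ) (x : Fin J → M) (y : Fin J → M') :
    convCoeff (c • e) J i x y = c • convCoeff e J i x y := by
  rw [convCoeff_def, convCoeff_def, Finset.smul_sum]
  rfl

/-- If two polynomials are congruent modulo `(n, X^J)` and the RIGHT argument is `n`-torsion-valued, they give the
same convolution coefficients on the left: `C_i(F(S)x, z) = C_i(G(S)x, z)` (`i < J`, `n • M' = 0`) — used with the
`p`-torsion test vector `z` to replace the `ω`-annihilating `V` by its residue `U·X^{L−e}` although `x` is only
`p^k`-torsion. [cite: MazurRubin2004, §1.3 and §5.3] -/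
theorem convCoeff_aeval_left_eq_of_forall_dvd_coeff_sub {n : ℕ} (hM' : ∀ y : M', n • y = 0) (F G : ℤ[X])
    (h : ∀ l, l < J → (n : ℤ) ∣ (F - G).coeff l) {i : ℕ} (hi : i < J) (x : Fin J → M) (z : Fin J → M') :
    convCoeff e J i (aeval (shiftEnd M J) F x) z = convCoeff e J i (aeval (shiftEnd M J) G x) z := by
  rw [convCoeff_aeval_comm e F hi, convCoeff_aeval_comm e G hi,
    aeval_shiftEnd_apply_eq_of_forall_dvd_coeff_sub hM' F G h z]

end Conv

/-! ## §3 The level change `L → J'` -/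

section Level

variable {M M' P : Type*} [AddCommGroup M] [AddCommGroup M'] [AddCommGroup P] (e : M →+ M' →+ P)

/-- Truncation `Fin L → Fin J'` (`J' ≤ L`) commutes with every polynomial in the shift.
[cite: Washington1997, §13.1–§13.2] -/
theorem aeval_shiftEnd_comp_castLE {L J' : ℕ} (h : J' ≤ L) (F : ℤ[X]) (x : Fin L → M) :
    (fun l : Fin J' => aeval (shiftEnd M L) F x (Fin.castLE h l)) =
      aeval (shiftEnd M J') F (fun l => x (Fin.castLE h l)) := by
  induction F using Polynomial.induction_on' with
  | add F G hF hG =>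
    rw [map_add, map_add, LinearMap.add_apply, LinearMap.add_apply, ← hF, ← hG]
    rfl
  | monomial i c =>
    rw [aeval_monomial, aeval_monomial, Module.End.mul_apply, Module.End.mul_apply,
      Module.algebraMap_end_apply, Module.algebraMap_end_apply]
    have hpow : ∀ (a : ℕ) (v : Fin L → M), (fun l : Fin J' => (shiftEnd M L ^ a) v (Fin.castLE h l)) =
        (shiftEnd M J' ^ a) (fun l => v (Fin.castLE h l)) := by
      intro a v
      induction a generalizing v with
      | zero => rfl
      | succ a ih =>
        rw [pow_succ, pow_succ, Module.End.mul_apply, Module.End.mul_apply, ih,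
          ZpExtension.shiftEnd_comp_castLE L h v]
    rw [← hpow]
    rfl

/-- **The level change**: for `J' ≤ L`, `i < J'`, an integer polynomial `U` and `b : ℕ`,
`C^{(J')}_i(U(S)·S^b x̄, ȳ) = C^{(L)}_{(L−J')+i}(U(S)·S^{(L−J')+b} x, y)`, where `x̄, ȳ` are the truncations of `x, y`
to level `J'` (low coefficients are truncation-invariant and `C_{a+i}(S^a v, y) = C_i(v, y)`).  With `L = 2e(d+1)`,
`J' = 2e`, `b = e`: the identity carrying the level-`L` reciprocity to the level-`2e` conclusion of the stub.
[cite: MazurRubin2004, §1.3 and §5.3] [cite: Washington1997, §13.1–§13.2] -/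
theorem convCoeff_castLE_aeval_shiftEnd_pow_eq {L J' : ℕ} (h : J' ≤ L) (U : ℤ[X]) (b : ℕ) (x : Fin L → M)
    (y : Fin L → M') {i : ℕ} (hi : i < J') :
    convCoeff e J' i (aeval (shiftEnd M J') U ((shiftEnd M J' ^ b) fun l => x (Fin.castLE h l)))
        (fun l => y (Fin.castLE h l)) =
      convCoeff e L (L - J' + i) (aeval (shiftEnd M L) U ((shiftEnd M L ^ (L - J' + b)) x)) y := by
  rw [pow_add, Module.End.mul_apply, aeval_shiftEnd_pow_apply U (L - J') ((shiftEnd M L ^ b) x),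
    convCoeff_shiftEnd_pow_left_eq e (L - J') (by omega) _ y, if_pos (by omega),
    show L - J' + i - (L - J') = i by omega]
  have hx : aeval (shiftEnd M J') U ((shiftEnd M J' ^ b) fun l => x (Fin.castLE h l)) =
      fun l => aeval (shiftEnd M L) U ((shiftEnd M L ^ b) x) (Fin.castLE h l) := by
    rw [aeval_shiftEnd_comp_castLE h U]
    congr 1
    have hb := aeval_shiftEnd_comp_castLE h (X ^ b) x
    simp only [map_pow, aeval_X] at hb
    exact hb.symm
  exact convCoeff_eq_of_apply_castLE_eq e h hi _ y _ _ (fun l => congrFun hx l) (fun l => rfl)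

end Level

end Summit.BirchSwinnertonDyer.BirchSwinnertonDyer.Theorems.OneSidedTwistSqueezeX9KatoDivisibilityX9StubReciprocityPkX9Transfer

end
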